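import Literature.Analysis.FluidPDE.OseenTensorComplex
import Literature.Analysis.FluidPDE.OseenTensorRepresentation
import Literature.Analysis.FluidPDE.HeatKernelTailBounds
import Literature.Analysis.FluidPDE.OseenFlatComplexHolomorphy
import HarnessLib

/-!
# The flat complex continuation of the projected heat potential and of the forcing term

Analysis/FluidPDE definitions-layer file for the proof of the named fact
`Literature.Analysis.FluidPDE.bradshawGrujicKukavica2015_local_analyticity_radius`
(Bradshaw–Grujić–Kukavica 2015, Thm. 2.3, §4: the forcing `∫_{s₀}^t e^{(t-s)Δ}P f₀(s) ds` of the
localised integral equation, `f₀` supported on the cut-off annulus, continued in the space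
variable at points far from the annulus). With the complexified Oseen tensor `𝒪_ℂ`
(`OseenTensorComplex.lean`) we define, for real fields `G` and families `G : ℝ → (ℝ^ι → ℝ^ι)`,

  `lerayHeatPotC ρ G ζ = ∫ 𝒪_ℂ(ρ, ζ - cx w) cx (G w) dw`       (flat: the contour stays real),
  `lerayHeatForcingC s₀ G t ζ = ∫_{(s₀,t)} lerayHeatPotC √(t-s) (G s) ζ ds`,

and prove:

* **real restriction** (`ι = Fin 3`): `lerayHeatPotC √τ G (cx x) = cx (e^{τΔ}P G)(x)` for test
  fields (`OseenTensorRepresentation.heatExtension_classicalLerayProj_eq_integral_oseenTensor`),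
  and the corresponding statement for the forcing (`lerayHeatForcingC_complexify`);
* **the off-diagonal bound** (`exists_forall_norm_lerayHeatPotC_le`): if the field vanishes
  within distance `D` of `x` and `‖y‖ ≤ D/2`, then
  `‖lerayHeatPotC ρ G (cx x + i cx y)‖ ≤ C ‖G‖_{L¹}` uniformly in `0 < ρ ≤ ρ₁` (sector bounds of
  `𝒪_ℂ` at admissible shifts, and the uniform off-diagonal bounds of the Gaussian and of the
  weights `A`, `A₁` from `HeatKernelTailBounds.lean` / `KochTataruKernel.lean` /
  `OseenTensorKernel.lean`), whence `‖lerayHeatForcingC‖ ≤ C (t - s₀) sup_s ‖G(s)‖_{L¹}`;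
* **holomorphy** of `ζ ↦ lerayHeatPotC ρ G ζ` for continuous compactly supported `G` (dominated
  holomorphy, constant majorant on a compact `(ζ, w)`-region), measurability in time, and
  holomorphy of the forcing under an integrable-in-time domination.

## References

* Z. Bradshaw, Z. Grujić, I. Kukavica, J. Differential Equations 259 (2015), §4, (4.2)–(4.4).
  [BradshawGrujicKukavica2015]
* P. G. Lemarié-Rieusset, *The Navier–Stokes Problem in the 21st Century* (2016), §6.2.
  [LemarieRieusset2016]
-/

noncomputable section

open MeasureTheory Set Function Filter Metric Real
open _root_.Topology
open scoped BigOperators ENNReal ContDiff InnerProductSpace RealInnerProductSpace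

namespace Literature.Analysis.FluidPDE

open Literature.Analysis.FunctionSpaces.EuclideanSpace (complexify complexify_apply norm_complexify
  continuous_complexify)
open UnboundedOperators (heatKernel heatExtension)

variable {ι : Type*} [Fintype ι]

/-! ### Definitions -/

/-- **The flat continuation of the projected heat potential** `e^{ρ²Δ}P G` of a real field:
`lerayHeatPotC ρ G ζ = ∫ 𝒪_ℂ(ρ, ζ - cx w) cx (G w) dw`. [cite: LemarieRieusset2016, §6.2] -/
def lerayHeatPotC (ρ : ℝ) (G : EuclideanSpace ℝ ι → EuclideanSpace ℝ ι) (ζ : EuclideanSpace ℂ ι) :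
    EuclideanSpace ℂ ι :=
  ∫ w, oseenTensorC (ρ : ℂ) (ζ - complexify w) (complexify (G w))

/-- **The flat continuation of the projected forcing**
`∫_{(s₀,t)} e^{(t-s)Δ}P G(s) ds`: `lerayHeatForcingC s₀ G t ζ = ∫_{(s₀,t)} lerayHeatPotC √(t-s) (G s) ζ ds`.
[cite: BradshawGrujicKukavica2015, §4 (4.2)–(4.4)] -/
def lerayHeatForcingC (s₀ : ℝ) (G : ℝ → EuclideanSpace ℝ ι → EuclideanSpace ℝ ι) (t : ℝ)
    (ζ : EuclideanSpace ℂ ι) : EuclideanSpace ℂ ι :=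
  ∫ s in Ioo s₀ t, lerayHeatPotC (Real.sqrt (t - s)) (G s) ζ

/-- Unfolding lemma. [folklore] -/
theorem lerayHeatPotC_apply (ρ : ℝ) (G : EuclideanSpace ℝ ι → EuclideanSpace ℝ ι) (ζ : EuclideanSpace ℂ ι) :
    lerayHeatPotC ρ G ζ = ∫ w, oseenTensorC (ρ : ℂ) (ζ - complexify w) (complexify (G w)) := rfl

/-- Unfolding lemma. [folklore] -/
theorem lerayHeatForcingC_apply (s₀ : ℝ) (G : ℝ → EuclideanSpace ℝ ι → EuclideanSpace ℝ ι) (t : ℝ)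
    (ζ : EuclideanSpace ℂ ι) :
    lerayHeatForcingC s₀ G t ζ = ∫ s in Ioo s₀ t, lerayHeatPotC (Real.sqrt (t - s)) (G s) ζ := rfl

/-! ### Real restriction (`ℝ³`) -/

/-- **Real restriction of the flat projected heat potential**: for a test field `G` on `ℝ³` and
`τ > 0`, `lerayHeatPotC √τ G (cx x) = cx (e^{τΔ}P G)(x)`. [cite: LemarieRieusset2016, §6.2] -/
theorem lerayHeatPotC_sqrt_complexify {G : EuclideanSpace ℝ (Fin 3) → EuclideanSpace ℝ (Fin 3)}
    (hG : ContDiff ℝ ∞ G) (hGc : HasCompactSupport G) {τ : ℝ} (hτ : 0 < τ) (x : EuclideanSpace ℝ (Fin 3)) :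
    lerayHeatPotC (Real.sqrt τ) G (complexify x) = complexify (heatExtension (classicalLerayProj G) τ x) := by
  rw [lerayHeatPotC_apply, heatExtension_classicalLerayProj_eq_integral_oseenTensor hG hGc hτ x,
    ← (complexify (ι := Fin 3)).integral_comp_comm]
  refine integral_congr_ae (Eventually.of_forall fun w => ?_)
  show oseenTensorC (Real.sqrt τ : ℂ) (complexify x - complexify w) (complexify (G w)) =
    complexify (oseenTensor τ (x - w) (G w))
  rw [← map_sub, oseenTensorC_sqrt_complexify hτ]

/-- **Real restriction of the flat forcing**: for a family of test fields on `ℝ³`,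
`lerayHeatForcingC s₀ G t (cx x) = cx (∫_{(s₀,t)} e^{(t-s)Δ}P G(s) (x) ds)`. [cite: BradshawGrujicKukavica2015, §4 (4.2)–(4.4)] -/
theorem lerayHeatForcingC_complexify {G : ℝ → EuclideanSpace ℝ (Fin 3) → EuclideanSpace ℝ (Fin 3)}
    {s₀ t : ℝ} (hG : ∀ s ∈ Ioo s₀ t, ContDiff ℝ ∞ (G s)) (hGc : ∀ s ∈ Ioo s₀ t, HasCompactSupport (G s))
    (x : EuclideanSpace ℝ (Fin 3)) :
    lerayHeatForcingC s₀ G t (complexify x) =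
      complexify (∫ s in Ioo s₀ t, heatExtension (classicalLerayProj (G s)) (t - s) x) := by
  rw [lerayHeatForcingC_apply, ← (complexify (ι := Fin 3)).integral_comp_comm]
  refine setIntegral_congr_fun measurableSet_Ioo fun s hs => ?_
  exact lerayHeatPotC_sqrt_complexify (hG s hs) (hGc s hs) (sub_pos.2 hs.2) x

/-! ### The integrand: size, vanishing, measurability -/

/-- The displacement `cx x + i cx y - cx w = cx (x - w) - i cx (-y)`. [folklore] -/
private theorem complexify_add_I_smul_sub'' (x y w : EuclideanSpace ℝ ι) :
    complexify x + Complex.I • complexify y - complexify w =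
      complexify (x - w) - Complex.I • complexify (-y) := by
  rw [map_sub, LinearIsometry.map_neg, smul_neg, sub_neg_eq_add]
  abel

/-- A crude operator bound for the complexified Oseen tensor:
`‖𝒪_ℂ(m, ξ) a‖ ≤ (‖heatKernelC m ξ‖ + ‖oseenWeightA1C m ξ‖ + ‖oseenWeightAC m ξ‖ ‖ξ‖²) ‖a‖`. [folklore] -/
theorem norm_oseenTensorC_le_opBound (m : ℂ) (ξ a : EuclideanSpace ℂ ι) :
    ‖oseenTensorC m ξ a‖ ≤ (‖heatKernelC m ξ‖ + ‖oseenWeightA1C m ξ‖ + ‖oseenWeightAC m ξ‖ * ‖ξ‖ ^ 2) * ‖a‖ := by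
  rw [oseenTensorC_apply]
  calc ‖(heatKernelC m ξ - oseenWeightA1C m ξ) • a + (oseenWeightAC m ξ * cdot ξ a) • ξ‖
      ≤ ‖(heatKernelC m ξ - oseenWeightA1C m ξ) • a‖ + ‖(oseenWeightAC m ξ * cdot ξ a) • ξ‖ := norm_add_le _ _
    _ ≤ (‖heatKernelC m ξ‖ + ‖oseenWeightA1C m ξ‖) * ‖a‖ + ‖oseenWeightAC m ξ‖ * (‖ξ‖ * ‖a‖) * ‖ξ‖ := by
        rw [norm_smul, norm_smul, norm_mul]
        gcongr
        · exact norm_sub_le _ _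
        · exact norm_cdot_le _ _
    _ = (‖heatKernelC m ξ‖ + ‖oseenWeightA1C m ξ‖ + ‖oseenWeightAC m ξ‖ * ‖ξ‖ ^ 2) * ‖a‖ := by ring

/-- For `ρ ≠ 0` the complexified Oseen tensor is jointly continuous in `(ξ, a)`. [folklore] -/
theorem continuous_oseenTensorC_of_ne_zero [Nonempty ι] {ρ : ℝ} (hρ : ρ ≠ 0) :
    Continuous fun q : EuclideanSpace ℂ ι × EuclideanSpace ℂ ι => oseenTensorC (ρ : ℂ) q.1 q.2 := by
  have hd : Differentiable ℂ fun q : EuclideanSpace ℂ ι × EuclideanSpace ℂ ι =>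
      oseenTensorC (ρ : ℂ) q.1 q.2 := fun q =>
    (differentiableAt_const _).oseenTensorC differentiableAt_fst differentiableAt_snd
      (Complex.ofReal_ne_zero.2 hρ)
  exact hd.continuous

/-- The operator-bound function of the complexified tensor is continuous in `ξ` (`ρ ≠ 0`).
[folklore] -/
theorem continuous_oseenTensorC_opBound [Nonempty ι] {ρ : ℝ} (hρ : ρ ≠ 0) :
    Continuous fun ξ : EuclideanSpace ℂ ι =>
      ‖heatKernelC (ρ : ℂ) ξ‖ + ‖oseenWeightA1C (ρ : ℂ) ξ‖ + ‖oseenWeightAC (ρ : ℂ) ξ‖ * ‖ξ‖ ^ 2 := by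
  have h0 : (ρ : ℂ) ≠ 0 := Complex.ofReal_ne_zero.2 hρ
  have h1 : Differentiable ℂ fun ξ : EuclideanSpace ℂ ι => heatKernelC (ρ : ℂ) ξ := fun ξ =>
    (differentiableAt_const _).heatKernelC differentiableAt_id h0
  have h2 : Differentiable ℂ fun ξ : EuclideanSpace ℂ ι => oseenWeightA1C (ρ : ℂ) ξ := fun ξ =>
    (differentiableAt_const _).oseenWeightA1C differentiableAt_id h0
  have h3 : Differentiable ℂ fun ξ : EuclideanSpace ℂ ι => oseenWeightAC (ρ : ℂ) ξ := fun ξ =>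
    (differentiableAt_const _).oseenWeightAC differentiableAt_id h0
  exact (h1.continuous.norm.add h2.continuous.norm).add (h3.continuous.norm.mul (continuous_norm.pow 2))

/-- Measurability in `w` of the flat integrand for a measurable field (`ρ ≠ 0`). [folklore] -/
theorem aestronglyMeasurable_lerayHeatPotC_integrand [Nonempty ι] {G : EuclideanSpace ℝ ι → EuclideanSpace ℝ ι}
    (hG : AEStronglyMeasurable G volume) {ρ : ℝ} (hρ : ρ ≠ 0) (ζ : EuclideanSpace ℂ ι) :
    AEStronglyMeasurable (fun w => oseenTensorC (ρ : ℂ) (ζ - complexify w) (complexify (G w))) volume := by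
  have h1 : AEStronglyMeasurable (fun w : EuclideanSpace ℝ ι => ζ - complexify w) volume :=
    (continuous_const.sub (continuous_complexify (ι := ι))).aestronglyMeasurable
  have h2 : AEStronglyMeasurable (fun w : EuclideanSpace ℝ ι => complexify (G w)) volume :=
    continuous_complexify.comp_aestronglyMeasurable hG
  have h := (continuous_oseenTensorC_of_ne_zero hρ).comp_aestronglyMeasurable (h1.prodMk h2)
  dsimp only at h
  exact h

/-! ### The off-diagonal bound -/

/-- **Uniform off-diagonal bound for the dilated weights**: for `D > 0`, `ρ₁ > 0` there is `C`
with `G_{τ'}(z) + A₁(τ',z) + (25/6)(3‖z‖/2+ρ)² A(τ',z) ≤ C` whenever `0 < ρ ≤ ρ₁`, `‖z‖ ≥ D`,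
`τ' = (25/6)ρ²` (positive dimension). [folklore] -/
theorem exists_offDiagonal_tensor_bound (E : Type*) [NormedAddCommGroup E] [InnerProductSpace ℝ E]
    (hE : 0 < Module.finrank ℝ E) {D : ℝ} (hD : 0 < D) {ρ₁ : ℝ} (hρ₁ : 0 < ρ₁) :
    ∃ C : ℝ, 0 ≤ C ∧ ∀ {ρ : ℝ}, 0 < ρ → ρ ≤ ρ₁ → ∀ {z : E}, D ≤ ‖z‖ →
      heatKernel (25 / 6 * ρ ^ 2) z + oseenWeightA1 (25 / 6 * ρ ^ 2) z +
        (25 / 6) * (3 * ‖z‖ / 2 + ρ) ^ 2 * oseenWeightA (25 / 6 * ρ ^ 2) z ≤ C := by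
  set d : ℝ := (Module.finrank ℝ E : ℝ) with hd
  have hd0 : 0 < d := by rw [hd]; exact_mod_cast hE
  obtain ⟨CG, hCG0, hCG⟩ := exists_forall_heatKernel_le_of_le_norm E hD (c₁ := 25 / 6 * ρ₁ ^ 2) (by positivity)
  obtain ⟨CA, hCA, hA⟩ := exists_oseenWeightA_le (E := E)
  obtain ⟨CA1, hCA1, hA1⟩ := exists_oseenWeightA1_le (E := E) hE
  -- the constants
  set K1 : ℝ := CA1 * (D ^ 2) ^ (-(d / 2)) with hK1
  set K2 : ℝ := (25 / 6) * (3 / 2 + ρ₁ / D) ^ 2 * CA * (D ^ 2) ^ (-(d / 2)) with hK2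
  refine ⟨CG + K1 + K2, by positivity, fun {ρ} hρ hρ₁' {z} hz => ?_⟩
  have hτ' : 0 < 25 / 6 * ρ ^ 2 := by positivity
  have hz0 : 0 < ‖z‖ := hD.trans_le hz
  obtain ⟨-, -, hAle⟩ := hA hτ' z
  obtain ⟨-, hA10, hA1le⟩ := hA1 hτ' z
  have hzD : D ^ 2 ≤ ‖z‖ ^ 2 := by nlinarith
  -- the Gaussian
  have h1 : heatKernel (25 / 6 * ρ ^ 2) z ≤ CG := hCG hτ' (by nlinarith) hz
  -- the weight `A₁`
  have h2 : oseenWeightA1 (25 / 6 * ρ ^ 2) z ≤ K1 := by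
    refine hA1le.trans ?_
    rw [hK1, ← hd]
    refine mul_le_mul_of_nonneg_left ?_ hCA1.le
    exact Real.rpow_le_rpow_of_nonpos (by positivity) (by nlinarith) (by linarith)
  -- the weight `A` with its quadratic factor
  have h3 : (25 / 6) * (3 * ‖z‖ / 2 + ρ) ^ 2 * oseenWeightA (25 / 6 * ρ ^ 2) z ≤ K2 := by
    have hq : (3 * ‖z‖ / 2 + ρ) ^ 2 ≤ (3 / 2 + ρ₁ / D) ^ 2 * ‖z‖ ^ 2 := by
      have hle : 3 * ‖z‖ / 2 + ρ ≤ (3 / 2 + ρ₁ / D) * ‖z‖ := by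
        rw [add_mul]
        have : ρ ≤ ρ₁ / D * ‖z‖ := by
          rw [div_mul_eq_mul_div, le_div_iff₀ hD]
          nlinarith
        linarith
      calc (3 * ‖z‖ / 2 + ρ) ^ 2 ≤ ((3 / 2 + ρ₁ / D) * ‖z‖) ^ 2 := by gcongr
        _ = (3 / 2 + ρ₁ / D) ^ 2 * ‖z‖ ^ 2 := by ring
    have hApow : oseenWeightA (25 / 6 * ρ ^ 2) z ≤ CA * (‖z‖ ^ 2) ^ (-(d / 2 + 1)) := by
      refine hAle.trans ?_
      rw [← hd]
      refine mul_le_mul_of_nonneg_left ?_ hCA.le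
      exact Real.rpow_le_rpow_of_nonpos (by positivity) (by nlinarith) (by linarith)
    have hzpow : ‖z‖ ^ 2 * (‖z‖ ^ 2) ^ (-(d / 2 + 1)) = (‖z‖ ^ 2) ^ (-(d / 2)) := by
      have hz2 : 0 < ‖z‖ ^ 2 := by positivity
      rw [show -(d / 2 + 1) = -(d / 2) + (-1 : ℝ) by ring, Real.rpow_add hz2, Real.rpow_neg_one]
      field_simp
    have hzpow' : (‖z‖ ^ 2) ^ (-(d / 2)) ≤ (D ^ 2) ^ (-(d / 2)) :=
      Real.rpow_le_rpow_of_nonpos (by positivity) hzD (by linarith)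
    obtain ⟨-, hA0, -⟩ := hA hτ' z
    calc (25 / 6) * (3 * ‖z‖ / 2 + ρ) ^ 2 * oseenWeightA (25 / 6 * ρ ^ 2) z
        ≤ (25 / 6) * ((3 / 2 + ρ₁ / D) ^ 2 * ‖z‖ ^ 2) * (CA * (‖z‖ ^ 2) ^ (-(d / 2 + 1))) := by
          gcongr
      _ = (25 / 6) * (3 / 2 + ρ₁ / D) ^ 2 * CA * (‖z‖ ^ 2 * (‖z‖ ^ 2) ^ (-(d / 2 + 1))) := by ring
      _ ≤ K2 := by
          rw [hzpow, hK2]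
          gcongr
  linarith

/-- **The off-diagonal bound for the flat projected heat potential.** For `D > 0`, `ρ₁ > 0` there
is `C` such that for `0 < ρ ≤ ρ₁`, a measurable integrable field `G` on `ℝ^ι` (`1 ≤ d`) vanishing
within distance `D` of `x`, `G w ≠ 0 → D ≤ ‖x - w‖`, and `‖y‖ ≤ D/2`:
`‖lerayHeatPotC ρ G (cx x + i cx y)‖ ≤ C ∫ ‖G w‖ dw`. [cite: BradshawGrujicKukavica2015, §4] -/
theorem exists_forall_norm_lerayHeatPotC_le [Nonempty ι] {D : ℝ} (hD : 0 < D) {ρ₁ : ℝ} (hρ₁ : 0 < ρ₁) :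
    ∃ C : ℝ, 0 ≤ C ∧ ∀ {ρ : ℝ}, 0 < ρ → ρ ≤ ρ₁ → ∀ (x y : EuclideanSpace ℝ ι)
      {G : EuclideanSpace ℝ ι → EuclideanSpace ℝ ι}, Integrable G →
      (∀ w, G w ≠ 0 → D ≤ ‖x - w‖) → ‖y‖ ≤ D / 2 →
        ‖lerayHeatPotC ρ G (complexify x + Complex.I • complexify y)‖ ≤ C * ∫ w, ‖G w‖ := by
  have hE : 0 < Module.finrank ℝ (EuclideanSpace ℝ ι) := by
    rw [finrank_euclideanSpace]; exact Fintype.card_pos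
  obtain ⟨C₀, hC₀0, hC₀⟩ := exists_offDiagonal_tensor_bound (EuclideanSpace ℝ ι) hE hD hρ₁
  set K₀ : ℝ := Real.exp 2 * (25 / 6 : ℝ) ^ ((Fintype.card ι : ℝ) / 2) with hK₀
  refine ⟨K₀ * C₀, by positivity, fun {ρ} hρ hρle x y {G} hGi hsupp hy => ?_⟩
  rw [lerayHeatPotC_apply]
  have hpt : ∀ w, ‖oseenTensorC (ρ : ℂ) (complexify x + Complex.I • complexify y - complexify w)
      (complexify (G w))‖ ≤ K₀ * C₀ * ‖G w‖ := by
    intro w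
    by_cases hw : G w = 0
    · simp [hw]
    · have hdist := hsupp w hw
      have hadm : ‖-y‖ ≤ ‖x - w‖ / 2 + ρ := by rw [norm_neg]; linarith
      rw [complexify_add_I_smul_sub'']
      refine (norm_oseenTensorC_imShift_le hρ hadm (complexify (G w))).trans ?_
      rw [norm_complexify, ← hK₀]
      refine mul_le_mul_of_nonneg_right ?_ (norm_nonneg _)
      exact mul_le_mul_of_nonneg_left (hC₀ hρ hρle hdist) (by positivity)
  calc ‖∫ w, oseenTensorC (ρ : ℂ) (complexify x + Complex.I • complexify y - complexify w) (complexify (G w))‖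
      ≤ ∫ w, K₀ * C₀ * ‖G w‖ := norm_integral_le_of_norm_le (hGi.norm.const_mul _) (Eventually.of_forall hpt)
    _ = K₀ * C₀ * ∫ w, ‖G w‖ := integral_const_mul _ _

/-- **Time integration of the off-diagonal bound**: if the flat potentials at times `s ∈ (s₀, t)`
are bounded by `K`, then `‖lerayHeatForcingC s₀ G t ζ‖ ≤ K (t - s₀)`. [folklore] -/
theorem norm_lerayHeatForcingC_le_of_forall {s₀ t : ℝ} (hst : s₀ ≤ t)
    {G : ℝ → EuclideanSpace ℝ ι → EuclideanSpace ℝ ι} {ζ : EuclideanSpace ℂ ι} {K : ℝ}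
    (hb : ∀ s ∈ Ioo s₀ t, ‖lerayHeatPotC (Real.sqrt (t - s)) (G s) ζ‖ ≤ K) :
    ‖lerayHeatForcingC s₀ G t ζ‖ ≤ K * (t - s₀) := by
  rw [lerayHeatForcingC_apply]
  have h := norm_setIntegral_le_of_norm_le_const (μ := (volume : Measure ℝ)) measure_Ioo_lt_top hb
  rwa [Measure.real, Real.volume_Ioo, ENNReal.toReal_ofReal (by linarith)] at h

/-! ### Holomorphy of the flat potential -/

/-- **Holomorphy of the flat projected heat potential** of a continuous compactly supported
field (`ρ > 0`), on every open set: dominated holomorphy with the constant majorant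
`(sup of the operator bound on a compact (ζ, w)-region) · ‖G w‖`. [folklore] -/
theorem differentiableOn_lerayHeatPotC [Nonempty ι] {G : EuclideanSpace ℝ ι → EuclideanSpace ℝ ι}
    (hG : Continuous G) (hGc : HasCompactSupport G) {ρ : ℝ} (hρ : 0 < ρ)
    {V : Set (EuclideanSpace ℂ ι)} (hV : IsOpen V) :
    DifferentiableOn ℂ (lerayHeatPotC ρ G) V := by
  obtain ⟨Rg, hRg⟩ : ∃ R : ℝ, tsupport G ⊆ closedBall (0 : EuclideanSpace ℝ ι) R :=
    (hGc.isCompact.isBounded).subset_closedBall 0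
  show DifferentiableOn ℂ (fun ζ => ∫ w, oseenTensorC (ρ : ℂ) (ζ - complexify w) (complexify (G w))) V
  refine Literature.Analysis.Complex.differentiableOn_integral_of_dominated
    (F := fun ζ w => oseenTensorC (ρ : ℂ) (ζ - complexify w) (complexify (G w))) ?_ ?_ ?_
  · exact fun ζ _ => aestronglyMeasurable_lerayHeatPotC_integrand hG.aestronglyMeasurable hρ.ne' ζ
  · exact Eventually.of_forall fun w ζ _ =>
      ((differentiableAt_const _).oseenTensorC (differentiableAt_id.sub_const _)
        (differentiableAt_const _) (Complex.ofReal_ne_zero.2 hρ.ne')).differentiableWithinAt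
  · intro ζ₀ hζ₀
    obtain ⟨R, hR, hball⟩ := Metric.isOpen_iff.1 hV ζ₀ hζ₀
    -- a bound for the operator-bound function on the compact region of displacements
    have hcont : Continuous fun q : EuclideanSpace ℂ ι × EuclideanSpace ℝ ι =>
        ‖heatKernelC (ρ : ℂ) (q.1 - complexify q.2)‖ + ‖oseenWeightA1C (ρ : ℂ) (q.1 - complexify q.2)‖ +
          ‖oseenWeightAC (ρ : ℂ) (q.1 - complexify q.2)‖ * ‖q.1 - complexify q.2‖ ^ 2 := by
      have h := (continuous_oseenTensorC_opBound hρ.ne').comp'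
        (continuous_fst.sub (continuous_complexify.comp continuous_snd) :
          Continuous fun q : EuclideanSpace ℂ ι × EuclideanSpace ℝ ι => q.1 - complexify q.2)
      exact h
    obtain ⟨B, hB⟩ := ((isCompact_closedBall ζ₀ R).prod (isCompact_closedBall (0 : EuclideanSpace ℝ ι) Rg)
      ).exists_bound_of_continuousOn hcont.continuousOn
    refine ⟨R, hR, hball, fun w => max B 0 * ‖G w‖,
      (hG.integrable_of_hasCompactSupport hGc).norm.const_mul _, Eventually.of_forall fun w ζ hζ => ?_⟩
    by_cases hw : G w = 0
    · simp [hw]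
    · have hws : w ∈ closedBall (0 : EuclideanSpace ℝ ι) Rg := hRg (subset_tsupport _ (Function.mem_support.2 hw))
      refine (norm_oseenTensorC_le_opBound _ _ _).trans ?_
      rw [norm_complexify]
      refine mul_le_mul_of_nonneg_right ?_ (norm_nonneg _)
      have h := hB (ζ, w) ⟨ball_subset_closedBall hζ, hws⟩
      rw [Real.norm_of_nonneg (by positivity)] at h
      exact h.trans (le_max_left _ _)

/-! ### Measurability in time and holomorphy of the forcing -/

/-- **Joint continuity of the complexified tensor in `(m, ξ, a)` on `m ≠ 0`.** [folklore] -/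
theorem continuousOn_oseenTensorC [Nonempty ι] :
    ContinuousOn (fun q : ℂ × EuclideanSpace ℂ ι × EuclideanSpace ℂ ι => oseenTensorC q.1 q.2.1 q.2.2)
      {q | q.1 ≠ 0} := by
  intro q hq
  have h : DifferentiableAt ℂ (fun r : ℂ × EuclideanSpace ℂ ι × EuclideanSpace ℂ ι =>
      oseenTensorC r.1 r.2.1 r.2.2) q :=
    differentiableAt_fst.oseenTensorC differentiableAt_snd.fst differentiableAt_snd.snd hq
  exact h.continuousAt.continuousWithinAt

/-- **Joint measurability of the flat time–space integrand of the forcing** for a jointly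
measurable slab family. [folklore] -/
theorem aestronglyMeasurable_lerayHeatPotC_integrand_timeSpace [Nonempty ι]
    {G : ℝ → EuclideanSpace ℝ ι → EuclideanSpace ℝ ι} {s₀ t : ℝ}
    (hG : AEStronglyMeasurable (uncurry G)
      ((volume : Measure (ℝ × EuclideanSpace ℝ ι)).restrict (Ioo s₀ t ×ˢ univ)))
    (ζ : EuclideanSpace ℂ ι) :
    AEStronglyMeasurable (fun z : ℝ × EuclideanSpace ℝ ι =>
      oseenTensorC ((Real.sqrt (t - z.1) : ℝ) : ℂ) (ζ - complexify z.2) (complexify (G z.1 z.2)))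
      (((volume : Measure ℝ).restrict (Ioo s₀ t)).prod (volume : Measure (EuclideanSpace ℝ ι))) := by
  classical
  set μ : Measure (ℝ × EuclideanSpace ℝ ι) :=
    ((volume : Measure ℝ).restrict (Ioo s₀ t)).prod (volume : Measure (EuclideanSpace ℝ ι)) with hμ
  have hμ' : μ = (volume : Measure (ℝ × EuclideanSpace ℝ ι)).restrict (Ioo s₀ t ×ˢ univ) := by
    rw [hμ, volume_restrict_prod_univ]
  set m : ℝ → ℝ := fun s => if s < t then Real.sqrt (t - s) else 1 with hm
  have hm_meas : Measurable m := Measurable.ite measurableSet_Iio (by fun_prop) measurable_const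
  have hm_ne : ∀ s, (m s : ℂ) ≠ 0 := fun s => by
    rw [hm]; by_cases hs : s < t
    · simp only [hs, if_true]; exact Complex.ofReal_ne_zero.2 (Real.sqrt_pos.2 (sub_pos.2 hs)).ne'
    · simp only [hs, if_false]; exact one_ne_zero
  set U : Set (ℂ × EuclideanSpace ℂ ι × EuclideanSpace ℂ ι) := {q | q.1 ≠ 0} with hU
  set f : ℝ × EuclideanSpace ℝ ι → ℂ × EuclideanSpace ℂ ι × EuclideanSpace ℂ ι :=
    fun z => ((m z.1 : ℂ), ζ - complexify z.2, complexify (G z.1 z.2)) with hf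
  have hfU : ∀ z, f z ∈ U := fun z => hm_ne z.1
  have hf_meas : AEMeasurable f μ := by
    have h1 : AEMeasurable (fun z : ℝ × EuclideanSpace ℝ ι => (m z.1 : ℂ)) μ :=
      (Complex.measurable_ofReal.comp (hm_meas.comp measurable_fst)).aemeasurable
    have h2 : AEMeasurable (fun z : ℝ × EuclideanSpace ℝ ι => ζ - complexify z.2) μ :=
      (continuous_const.sub (continuous_complexify.comp continuous_snd)).measurable.aemeasurable
    have h3 : AEMeasurable (fun z : ℝ × EuclideanSpace ℝ ι => complexify (G z.1 z.2)) μ := by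
      rw [hμ']; exact (continuous_complexify.comp_aestronglyMeasurable hG).aemeasurable
    exact h1.prodMk (h2.prodMk h3)
  have hfr : AEStronglyMeasurable (codRestrict f U hfU) μ :=
    (hf_meas.subtype_mk (hfs := hfU)).aestronglyMeasurable
  have hKc : Continuous (U.restrict fun q : ℂ × EuclideanSpace ℂ ι × EuclideanSpace ℂ ι =>
      oseenTensorC q.1 q.2.1 q.2.2) :=
    continuousOn_iff_continuous_restrict.1 continuousOn_oseenTensorC
  have hcomp := hKc.comp_aestronglyMeasurable hfr
  have hcomp' : AEStronglyMeasurable (fun z : ℝ × EuclideanSpace ℝ ι =>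
      oseenTensorC (m z.1 : ℂ) (ζ - complexify z.2) (complexify (G z.1 z.2))) μ :=
    hcomp.congr (Eventually.of_forall fun z => rfl)
  refine hcomp'.congr ?_
  have hae : ∀ᵐ z ∂μ, z.1 ∈ Ioo s₀ t := by
    rw [hμ', ae_restrict_iff' (measurableSet_Ioo.prod MeasurableSet.univ)]
    exact Eventually.of_forall fun z hz => hz.1
  filter_upwards [hae] with z hz
  simp only [hm, hz.2, if_true]

/-- **Measurability in time of the flat potentials** `s ↦ lerayHeatPotC √(t-s) (G s) ζ` on `(s₀,t)`.
[folklore] -/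
theorem aestronglyMeasurable_lerayHeatPotC_time [Nonempty ι] {G : ℝ → EuclideanSpace ℝ ι → EuclideanSpace ℝ ι}
    {s₀ t : ℝ}
    (hG : AEStronglyMeasurable (uncurry G)
      ((volume : Measure (ℝ × EuclideanSpace ℝ ι)).restrict (Ioo s₀ t ×ˢ univ)))
    (ζ : EuclideanSpace ℂ ι) :
    AEStronglyMeasurable (fun s => lerayHeatPotC (Real.sqrt (t - s)) (G s) ζ)
      ((volume : Measure ℝ).restrict (Ioo s₀ t)) := by
  have h := (aestronglyMeasurable_lerayHeatPotC_integrand_timeSpace hG ζ).integral_prod_right'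
  exact h.congr (Eventually.of_forall fun s => rfl)

/-- **Holomorphy of the flat forcing** under an integrable-in-time domination: for a jointly
measurable slab family of continuous compactly supported fields, an open `V`, and
`‖lerayHeatPotC √(t-s) (G s) ζ‖ ≤ bound s` on `V × (s₀,t)` with `bound` integrable,
`ζ ↦ lerayHeatForcingC s₀ G t ζ` is holomorphic on `V`. [folklore] -/
theorem differentiableOn_lerayHeatForcingC [Nonempty ι] {G : ℝ → EuclideanSpace ℝ ι → EuclideanSpace ℝ ι}
    {s₀ t : ℝ}
    (hG : AEStronglyMeasurable (uncurry G)
      ((volume : Measure (ℝ × EuclideanSpace ℝ ι)).restrict (Ioo s₀ t ×ˢ univ)))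
    (hGs : ∀ s ∈ Ioo s₀ t, Continuous (G s)) (hGc : ∀ s ∈ Ioo s₀ t, HasCompactSupport (G s))
    {V : Set (EuclideanSpace ℂ ι)} (hV : IsOpen V)
    {bound : ℝ → ℝ} (hbi : IntegrableOn bound (Ioo s₀ t))
    (hdom : ∀ ζ ∈ V, ∀ s ∈ Ioo s₀ t, ‖lerayHeatPotC (Real.sqrt (t - s)) (G s) ζ‖ ≤ bound s) :
    DifferentiableOn ℂ (lerayHeatForcingC s₀ G t) V := by
  set μ : Measure ℝ := (volume : Measure ℝ).restrict (Ioo s₀ t) with hμ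
  have hae : ∀ᵐ s ∂μ, s ∈ Ioo s₀ t := by rw [hμ]; exact ae_restrict_mem measurableSet_Ioo
  show DifferentiableOn ℂ (fun ζ => ∫ s in Ioo s₀ t, lerayHeatPotC (Real.sqrt (t - s)) (G s) ζ) V
  refine Literature.Analysis.Complex.differentiableOn_integral_of_dominated (μ := μ)
    (F := fun ζ s => lerayHeatPotC (Real.sqrt (t - s)) (G s) ζ) ?_ ?_ ?_
  · exact fun ζ _ => aestronglyMeasurable_lerayHeatPotC_time hG ζ
  · filter_upwards [hae] with s hs
    exact differentiableOn_lerayHeatPotC (hGs s hs) (hGc s hs) (Real.sqrt_pos.2 (sub_pos.2 hs.2)) hV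
  · intro ζ₀ hζ₀
    obtain ⟨R, hR, hball⟩ := Metric.isOpen_iff.1 hV ζ₀ hζ₀
    refine ⟨R, hR, hball, bound, hbi, ?_⟩
    filter_upwards [hae] with s hs ζ hζ
    exact hdom ζ (hball hζ) s hs

end Literature.Analysis.FluidPDE
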